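import Literature.IUT.HodgeTheaters.GlobalFrobenioidsCoricRigidityIndependence
import Literature.IUT.HodgeTheaters.GlobalFrobenioidsCyclotomeRigidityZHat
import HarnessLib

/-!
# [IUTchI] Example 5.1 (v): "unique up to a uniquely determined isomorphism" — the ∞κ-coric RIGIDITY of
# the model pair DERIVED from its two printed inputs, typed as explicit Lean-signature laws

S. Mochizuki, *Inter-universal Teichmüller theory I*, kurims manuscript (May 2020), §5, Example 5.1 (v)
p. 127 l. 75 – p. 128 l. 24 and p. 128 l. 49–54 ([IUTchI] Ex 5.1 (v) pp.127–128) [claim: Mochizuki2012,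
status: disputed]: "consideration of Kummer classes … yields a natural injection of `†𝕄^⊛_∞κ` … into
`lim_H H¹(H, μ_Ẑ(†𝕄^⊛_∞κ))` … it follows immediately, by considering divisors of zeroes and poles [cf. the
definition of a "`κ`-coric function" given in Remark 3.1.7, (i)] associated to Kummer classes of rational
functions as in [AbsTopIII], Proposition 1.6, (iii), from the elementary observation that, relative to the
natural inclusion `ℚ ↪ Ẑ ⊗ ℚ`, `ℚ_{>0} ∩ Ẑ^× = {1}`, that there exists a unique isomorphism of cyclotomes
… `†ℱ^⊛` always admits an ∞κ-coric (respectively, ∞κ×-coric) structure, which is, moreover, unique up to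
a uniquely determined isomorphism"; Remark 3.1.7 (i) p. 67 l. 1–2: "whenever `f ∉ L̄`, it holds that,
over `L̄`, `f` has precisely one pole [of unrestricted order], but at least two distinct zeroes"; (ii) p. 67
l. 23–25: "there exists a `κ`-coric `f_sol` … of degree 4".

Cell abc-iut, sub-DAG `plan/L5/SUBDAG-IUTchI-Ex51.md` rows E51/L27 (b), E51/L29 (index seat
abc-iut-w5-d110); GAP-LEDGER row G-w4d056-2 (owner: the SUBDAG holder), whose disposition D-row
(abc-iut-w4-d056, 03:48Z) records: law (b) "`ℚ_{>0} ∩ Ẑ^× = {1}`" LANDED in `Ẑ^×`-form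
(`GlobalFrobenioidsCyclotomeRigidityZHat.lean`: `CyclotomeRigidity.eq_one_of_two_zeros_one_pole`), and the row
stays open for (a) the NATURALITY of the Kummer map under automorphisms of the coric pair and (b′) the
DIVISOR TRANSPORT law ([AbsTopIII] Prop. 1.6 (iii): Kummer classes of rational functions have integer
divisors, on which `Ẑ^×` acts by multiplication) — both INTERFACE laws of the §3/§5 + Kummer-map merge which
the Example 5.1 (i) interface `NFBridgeRecon` does not carry (kernel certificate of their necessity:
`NFBridgeRecon.exists_recon_not_existsUniqueCoricStructure`, `GlobalFrobenioidsCoricRigidityIndependence.lean`).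

## What is proved (theorems only; the two laws are EXPLICIT HYPOTHESES in Lean-signature form, no new def)

For ANY coric pair `model` (abc-iut-L5-t1's `CoricPair Γ`) with a Kummer realisation `κ` (abc-iut-L5-t12's
`CoricPair.KummerRealization`) in a container `H` on which `Ẑ^× = Aut(Ẑ)` acts (`twist`, with `twist 1 = id` —
the functoriality of `lim_H H¹(H, μ_Ẑ(𝕄))` in `Aut(μ_Ẑ(𝕄)) = Ẑ^×`; only the unit law is used):

* `CoricPair.kummerRigid_of_laws` — **(a) + (b′) + Rmk 3.1.7 (i)/(ii) ⟹ Kummer rigidity**: if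
  (a) every automorphism `e` of the pair transports `κ` by some `u_e ∈ Ẑ^×` (`κ ∘ e = u_e · κ`), and
  (b′) whenever `κ ∘ e = u · κ`, the order `ord_x` at every point `x` is transported, `u(ord_x f) = ord_x(e f)`
  in `Ẑ` (the tree's `ZHatLevel.eta : ℤ → Ẑ`), while the pair obeys Rmk 3.1.7 (i)/(ii) — SOME member has two
  distinct zeroes and EVERY member has at most one pole — then every automorphism of the pair is
  `κ`-compatible (`κ ∘ e = κ`: abc-iut-w5-d110's hypothesis `hrigid`);
* `CoricPair.iso_eq_refl_of_laws` — hence the pair has no automorphism but the identity;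
* `existsUniqueCoricStructure_of_laws` — hence abc-iut-L5-t1's typed Example 5.1 (v) display
  `ExistsUniqueCoricStructure Γ model` ("unique up to a uniquely determined isomorphism");
* `NFBridgeRecon.existsUniqueCoricStructure_infκPair_of_laws` / `…_infκxPair_of_laws` — the literal typed
  statements at the two MODEL pairs `π₁^rat(†𝒟^⊛) ↷ 𝕄^⊛_∞κ(†𝒟^⊚)` / `𝕄^⊛_∞κ×` of Example 5.1 (i)/(v);
* `NFBridgeRecon.not_laws_of_not_existsUniqueCoricStructure` — CONTENT CHECK: at abc-iut-w4-d056's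
  independence witness (where the typed uniqueness FAILS) the law bundle is therefore NOT satisfiable — the
  binders are load-bearing, not idle.

The arithmetic is abc-iut-w4-d056's `CyclotomeRigidity.eq_one_of_two_zeros_one_pole` ("`u = 1` in `Aut(Ẑ)`",
built on abc-iut-w5-d110's exponent engine and abc-iut-w4-d024's `ZHatLevel`), consumed BY NAME.
HONEST FRAMING: the laws (a), (b′) and the Rmk 3.1.7 clauses AT THE PAIR are typed, not proved — they are
exactly GAP row G-w4d056-2's wanted interface statements; nothing here asserts a disputed claim or takes a side
on [IUTchIII] Cor. 3.12; typed ≠ proved.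
-/

namespace Literature.IUT.HodgeTheaters

open ProfiniteGrp ProfiniteGrp.ProfiniteCompletion
open Literature.AnabelianGeometry.EtaleTheta Literature.AnabelianGeometry.EtaleTheta.ZHatLevel

universe u v

/-! ### 1. Kummer rigidity of a coric pair from the two printed laws -/

namespace CoricPair

variable {Γ : Type u} [Group Γ] [TopologicalSpace Γ] {model : CoricPair Γ} {H : Type u} [CommGroup H]
  [MulAction Γ H]

/-- **Ex. 5.1 (v), pp. 127–128 — Kummer rigidity of the pair from (a) NATURALITY + (b′) DIVISOR TRANSPORT +
Rmk 3.1.7 (i)/(ii).**  Let `κ` be a Kummer realisation of the coric pair `model` in a container `H` carrying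
an action `twist` of `Ẑ^× = Aut(Ẑ)` with `twist 1 = id`.  Suppose:
(a) every automorphism `e` of the pair transports `κ` by a unit, `κ(e x) = twist u (κ x)` for some `u ∈ Ẑ^×`
["the resulting isomorphism between direct limits of cohomology modules", p. 128 l. 20–22, composed with
`Aut(μ_Ẑ(𝕄)) = Ẑ^×`];
(b′) such a `u` multiplies the integer divisors: `u(ord_x f) = ord_x(e f)` in `Ẑ` for every member `f` and
point `x` ["divisors of zeroes and poles … associated to Kummer classes of rational functions as in
[AbsTopIII], Proposition 1.6, (iii)", p. 128 l. 15–17];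
(Rmk 3.1.7 (i)/(ii)) some member has two distinct zeroes, and every member has at most one pole
["precisely one pole … but at least two distinct zeroes", p. 67 l. 1–2; "there exists a κ-coric `f_sol`",
p. 67 l. 24].
Then every automorphism of the pair is `κ`-compatible — "`ℚ_{>0} ∩ Ẑ^× = {1}`" (abc-iut-w4-d056's
`CyclotomeRigidity.eq_one_of_two_zeros_one_pole`) forces `u = 1`. ([IUTchI] Ex 5.1 (v) pp.127–128)
[claim: Mochizuki2012, status: disputed] -/
theorem kummerRigid_of_laws (κ : model.KummerRealization H)
    (twist : MulAut (completion (GrpCat.of (Multiplicative ℤ))) → H → H) (htwist_one : ∀ h, twist 1 h = h)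
    (hnat : ∀ e : Iso model model, ∃ u : MulAut (completion (GrpCat.of (Multiplicative ℤ))),
      ∀ x, κ.toFun (e.toEquiv x) = twist u (κ.toFun x))
    {Pt : Type v} (ord : Pt → model.carrier → ℤ)
    (hord : ∀ (e : Iso model model) (u : MulAut (completion (GrpCat.of (Multiplicative ℤ)))),
      (∀ x, κ.toFun (e.toEquiv x) = twist u (κ.toFun x)) →
        ∀ (f : model.carrier) (x : Pt), u (eta (ord x f)) = eta (ord x (e.toEquiv f)))
    (htwo : ∃ (f : model.carrier) (x₁ x₂ : Pt), x₁ ≠ x₂ ∧ 0 < ord x₁ f ∧ 0 < ord x₂ f)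
    (hone : ∀ (f : model.carrier) (x₁ x₂ : Pt), x₁ ≠ x₂ → ¬ (ord x₁ f < 0 ∧ ord x₂ f < 0)) :
    ∀ e : Iso model model, e.IsCompatible κ κ := by
  intro e x
  obtain ⟨u, hu⟩ := hnat e
  obtain ⟨f, x₁, x₂, hne, h₁, h₂⟩ := htwo
  have hu1 : u = 1 :=
    CyclotomeRigidity.eq_one_of_two_zeros_one_pole u h₁ h₂ (hone (e.toEquiv f) x₁ x₂ hne)
      (hord e u hu f x₁) (hord e u hu f x₂)
  rw [hu x, hu1, htwist_one]

/-- **Corollary — the pair is RIGID**: under the laws of `kummerRigid_of_laws` the only automorphism of the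
pair is the identity (abc-iut-L5-t12's `Iso.eq_of_isCompatible`: injectivity of the Kummer map).
([IUTchI] Ex 5.1 (v) p.128) [claim: Mochizuki2012, status: disputed] -/
theorem iso_eq_refl_of_laws (κ : model.KummerRealization H)
    (twist : MulAut (completion (GrpCat.of (Multiplicative ℤ))) → H → H) (htwist_one : ∀ h, twist 1 h = h)
    (hnat : ∀ e : Iso model model, ∃ u : MulAut (completion (GrpCat.of (Multiplicative ℤ))),
      ∀ x, κ.toFun (e.toEquiv x) = twist u (κ.toFun x))
    {Pt : Type v} (ord : Pt → model.carrier → ℤ)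
    (hord : ∀ (e : Iso model model) (u : MulAut (completion (GrpCat.of (Multiplicative ℤ)))),
      (∀ x, κ.toFun (e.toEquiv x) = twist u (κ.toFun x)) →
        ∀ (f : model.carrier) (x : Pt), u (eta (ord x f)) = eta (ord x (e.toEquiv f)))
    (htwo : ∃ (f : model.carrier) (x₁ x₂ : Pt), x₁ ≠ x₂ ∧ 0 < ord x₁ f ∧ 0 < ord x₂ f)
    (hone : ∀ (f : model.carrier) (x₁ x₂ : Pt), x₁ ≠ x₂ → ¬ (ord x₁ f < 0 ∧ ord x₂ f < 0))
    (e : Iso model model) : e = Iso.refl model :=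
  Iso.eq_of_isCompatible (kummerRigid_of_laws κ twist htwist_one hnat ord hord htwo hone e)
    (fun _ => rfl)

end CoricPair

/-! ### 2. The typed display of Example 5.1 (v) under the laws -/

section Display

variable {Γ : Type u} [Group Γ] [TopologicalSpace Γ] {model : CoricPair Γ} {H : Type u} [CommGroup H]
  [MulAction Γ H]

/-- **Ex. 5.1 (v), p. 128 "`†ℱ^⊛` always admits an ∞κ-coric (respectively, ∞κ×-coric) structure, which is,
moreover, unique up to a uniquely determined isomorphism" — abc-iut-L5-t1's typed
`ExistsUniqueCoricStructure Γ model`, DERIVED from the printed inputs**: the Kummer realisation `κ` with its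
`Ẑ^×`-naturality (a), the divisor transport (b′) of [AbsTopIII] Prop. 1.6 (iii), and Rmk 3.1.7 (i)/(ii) at the
pair (via abc-iut-w5-d110's reduction `existsUniqueCoricStructure_of_kummerRigid`).
([IUTchI] Ex 5.1 (v) p.128) [claim: Mochizuki2012, status: disputed] -/
theorem existsUniqueCoricStructure_of_laws (κ : model.KummerRealization H)
    (twist : MulAut (completion (GrpCat.of (Multiplicative ℤ))) → H → H) (htwist_one : ∀ h, twist 1 h = h)
    (hnat : ∀ e : CoricPair.Iso model model, ∃ u : MulAut (completion (GrpCat.of (Multiplicative ℤ))),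
      ∀ x, κ.toFun (e.toEquiv x) = twist u (κ.toFun x))
    {Pt : Type v} (ord : Pt → model.carrier → ℤ)
    (hord : ∀ (e : CoricPair.Iso model model) (u : MulAut (completion (GrpCat.of (Multiplicative ℤ)))),
      (∀ x, κ.toFun (e.toEquiv x) = twist u (κ.toFun x)) →
        ∀ (f : model.carrier) (x : Pt), u (eta (ord x f)) = eta (ord x (e.toEquiv f)))
    (htwo : ∃ (f : model.carrier) (x₁ x₂ : Pt), x₁ ≠ x₂ ∧ 0 < ord x₁ f ∧ 0 < ord x₂ f)
    (hone : ∀ (f : model.carrier) (x₁ x₂ : Pt), x₁ ≠ x₂ → ¬ (ord x₁ f < 0 ∧ ord x₂ f < 0)) :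
    ExistsUniqueCoricStructure Γ model :=
  existsUniqueCoricStructure_of_kummerRigid κ
    (CoricPair.kummerRigid_of_laws κ twist htwist_one hnat ord hord htwo hone)

end Display

/-! ### 3. At the MODEL pairs of Example 5.1 (i)/(v): `π₁^rat(†𝒟^⊛) ↷ 𝕄^⊛_∞κ(†𝒟^⊚)`, `𝕄^⊛_∞κ×(†𝒟^⊚)` -/

namespace NFBridgeRecon

variable (N : NFBridgeRecon.{u}) {H : Type u} [CommGroup H] [MulAction N.piRat H]

/-- **Ex. 5.1 (v) at the model ∞κ-pair** (sub-DAG rows E51/L27 (b), E51/L29; GAP G-w4d056-2): the typed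
`ExistsUniqueCoricStructure π₁^rat 𝕄^⊛_∞κ` follows from a Kummer realisation of abc-iut-w5-d110's model
pair `N.infκPair` together with the laws (a), (b′) and Rmk 3.1.7 (i)/(ii) for the ∞κ-coric rational
functions. ([IUTchI] Ex 5.1 (v) p.128) [claim: Mochizuki2012, status: disputed] -/
theorem existsUniqueCoricStructure_infκPair_of_laws (κ : N.infκPair.KummerRealization H)
    (twist : MulAut (completion (GrpCat.of (Multiplicative ℤ))) → H → H) (htwist_one : ∀ h, twist 1 h = h)
    (hnat : ∀ e : CoricPair.Iso N.infκPair N.infκPair,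
      ∃ u : MulAut (completion (GrpCat.of (Multiplicative ℤ))), ∀ x, κ.toFun (e.toEquiv x) = twist u (κ.toFun x))
    {Pt : Type v} (ord : Pt → N.infκPair.carrier → ℤ)
    (hord : ∀ (e : CoricPair.Iso N.infκPair N.infκPair)
      (u : MulAut (completion (GrpCat.of (Multiplicative ℤ)))),
      (∀ x, κ.toFun (e.toEquiv x) = twist u (κ.toFun x)) →
        ∀ (f : N.infκPair.carrier) (x : Pt), u (eta (ord x f)) = eta (ord x (e.toEquiv f)))
    (htwo : ∃ (f : N.infκPair.carrier) (x₁ x₂ : Pt), x₁ ≠ x₂ ∧ 0 < ord x₁ f ∧ 0 < ord x₂ f)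
    (hone : ∀ (f : N.infκPair.carrier) (x₁ x₂ : Pt), x₁ ≠ x₂ → ¬ (ord x₁ f < 0 ∧ ord x₂ f < 0)) :
    ExistsUniqueCoricStructure N.piRat N.infκPair :=
  existsUniqueCoricStructure_of_laws κ twist htwist_one hnat ord hord htwo hone

/-- **Ex. 5.1 (v) at the model ∞κ×-pair** ("respectively, ∞κ×-coric"): the same derivation for
`N.infκxPair`. ([IUTchI] Ex 5.1 (v) p.128) [claim: Mochizuki2012, status: disputed] -/
theorem existsUniqueCoricStructure_infκxPair_of_laws (κ : N.infκxPair.KummerRealization H)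
    (twist : MulAut (completion (GrpCat.of (Multiplicative ℤ))) → H → H) (htwist_one : ∀ h, twist 1 h = h)
    (hnat : ∀ e : CoricPair.Iso N.infκxPair N.infκxPair,
      ∃ u : MulAut (completion (GrpCat.of (Multiplicative ℤ))), ∀ x, κ.toFun (e.toEquiv x) = twist u (κ.toFun x))
    {Pt : Type v} (ord : Pt → N.infκxPair.carrier → ℤ)
    (hord : ∀ (e : CoricPair.Iso N.infκxPair N.infκxPair)
      (u : MulAut (completion (GrpCat.of (Multiplicative ℤ)))),
      (∀ x, κ.toFun (e.toEquiv x) = twist u (κ.toFun x)) →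
        ∀ (f : N.infκxPair.carrier) (x : Pt), u (eta (ord x f)) = eta (ord x (e.toEquiv f)))
    (htwo : ∃ (f : N.infκxPair.carrier) (x₁ x₂ : Pt), x₁ ≠ x₂ ∧ 0 < ord x₁ f ∧ 0 < ord x₂ f)
    (hone : ∀ (f : N.infκxPair.carrier) (x₁ x₂ : Pt), x₁ ≠ x₂ → ¬ (ord x₁ f < 0 ∧ ord x₂ f < 0)) :
    ExistsUniqueCoricStructure N.piRat N.infκxPair :=
  existsUniqueCoricStructure_of_laws κ twist htwist_one hnat ord hord htwo hone

/-- **CONTENT CHECK — the laws are load-bearing.**  At any instance of the Example 5.1 (i) interface whose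
model ∞κ-pair FAILS the typed uniqueness (abc-iut-w4-d056's independence witness
`exists_recon_not_existsUniqueCoricStructure`: all coric sets `ℂ ∖ {0}`, automorphism `f ↦ f⁻¹`), NO Kummer
realisation, `Ẑ^×`-action and order map satisfy the law bundle (a) + (b′) + Rmk 3.1.7 (i)/(ii): the printed
inputs EXCLUDE that witness, as the D-row of G-w4d056-2 states in prose.
([IUTchI] Ex 5.1 (v) p.128) [claim: Mochizuki2012, status: disputed] -/
theorem not_laws_of_not_existsUniqueCoricStructure (hN : ¬ ExistsUniqueCoricStructure N.piRat N.infκPair)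
    (κ : N.infκPair.KummerRealization H)
    (twist : MulAut (completion (GrpCat.of (Multiplicative ℤ))) → H → H) (htwist_one : ∀ h, twist 1 h = h)
    {Pt : Type v} (ord : Pt → N.infκPair.carrier → ℤ) :
    ¬ ((∀ e : CoricPair.Iso N.infκPair N.infκPair,
          ∃ u : MulAut (completion (GrpCat.of (Multiplicative ℤ))),
            ∀ x, κ.toFun (e.toEquiv x) = twist u (κ.toFun x)) ∧
        (∀ (e : CoricPair.Iso N.infκPair N.infκPair)
          (u : MulAut (completion (GrpCat.of (Multiplicative ℤ)))),
          (∀ x, κ.toFun (e.toEquiv x) = twist u (κ.toFun x)) →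
            ∀ (f : N.infκPair.carrier) (x : Pt), u (eta (ord x f)) = eta (ord x (e.toEquiv f))) ∧
        (∃ (f : N.infκPair.carrier) (x₁ x₂ : Pt), x₁ ≠ x₂ ∧ 0 < ord x₁ f ∧ 0 < ord x₂ f) ∧
        (∀ (f : N.infκPair.carrier) (x₁ x₂ : Pt), x₁ ≠ x₂ → ¬ (ord x₁ f < 0 ∧ ord x₂ f < 0))) :=
  fun ⟨hnat, hord, htwo, hone⟩ =>
    hN (N.existsUniqueCoricStructure_infκPair_of_laws κ twist htwist_one hnat ord hord htwo hone)

/-- Consequently the law bundle is not satisfiable at SOME instance of the Example 5.1 (i) interface (the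
independence witness): the universal closure of "laws ⟹ uniqueness" is a theorem, the universal closure of
the laws themselves is not — they are genuine constraints to be supplied by the §3/§5 + Kummer-map merge
(GAP G-w4d056-2 (a), (b′)). ([IUTchI] Ex 5.1 (v) p.128) [claim: Mochizuki2012, status: disputed] -/
theorem exists_recon_not_laws : ∃ N : NFBridgeRecon.{0}, ∀ (H : Type) [CommGroup H] [MulAction N.piRat H]
    (κ : N.infκPair.KummerRealization H)
    (twist : MulAut (completion (GrpCat.of (Multiplicative ℤ))) → H → H), (∀ h, twist 1 h = h) →
    ∀ {Pt : Type v} (ord : Pt → N.infκPair.carrier → ℤ),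
    ¬ ((∀ e : CoricPair.Iso N.infκPair N.infκPair,
          ∃ u : MulAut (completion (GrpCat.of (Multiplicative ℤ))),
            ∀ x, κ.toFun (e.toEquiv x) = twist u (κ.toFun x)) ∧
        (∀ (e : CoricPair.Iso N.infκPair N.infκPair)
          (u : MulAut (completion (GrpCat.of (Multiplicative ℤ)))),
          (∀ x, κ.toFun (e.toEquiv x) = twist u (κ.toFun x)) →
            ∀ (f : N.infκPair.carrier) (x : Pt), u (eta (ord x f)) = eta (ord x (e.toEquiv f))) ∧
        (∃ (f : N.infκPair.carrier) (x₁ x₂ : Pt), x₁ ≠ x₂ ∧ 0 < ord x₁ f ∧ 0 < ord x₂ f) ∧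
        (∀ (f : N.infκPair.carrier) (x₁ x₂ : Pt), x₁ ≠ x₂ → ¬ (ord x₁ f < 0 ∧ ord x₂ f < 0))) := by
  obtain ⟨N, hN⟩ := exists_recon_not_existsUniqueCoricStructure
  exact ⟨N, fun H _ _ κ twist htwist_one Pt ord =>
    N.not_laws_of_not_existsUniqueCoricStructure (fun h => hN.2.2.1 h) κ twist htwist_one ord⟩

end NFBridgeRecon

end Literature.IUT.HodgeTheaters
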